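import Summits.BirchSwinnertonDyer.BirchSwinnertonDyer.Theorems.ResidualThetaTransportAtTwoPollackPairKUnique
import HarnessLib

/-!
# The analytic exponent `d` of crux (R≥)ᵖ `ResidualThetaCountLowerPureAtTwo` (stmt-BirchSwinnertonDyer-26074) is an invariant of
# `(g, ι, Ω)` (line «bt26-lambda»; lead prover bsd-wall-rtt-p2 g13; `--supports` only)

THEOREMS ONLY; nothing about any curve is asserted; BSD is not proved by any of this. The crux binds an `𝒪`-Pollack pair `(L⁺, L⁻)`
(`IsPollackPairK g ι Ω L⁺ L⁻`) and an exponent `d` pinned to `L⁻` by the two norm binders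
`∀ k, ‖c_k(L⁻)‖ ≤ ‖c_d(L⁻)‖` and `∀ k < d, ‖c_k(L⁻)‖ < ‖c_d(L⁻)‖` (`d` = the first index of a coefficient of maximal norm = the
λ-invariant of `L⁻`, cf. `LambdaLowerBoundO.finrank_quotientTorsion_quotient_span_eq_of_normLambda_iwasawaAlgebraO`). Here:
`normLambda_unique` — such a `d` is unique for a given series; `exponent_eq_of_isPollackPairK` — with
`PollackPairK.isPollackPairK_unique` (the pair itself is unique), two admissible `(L⁺, L⁻, d)`, `(L⁺', L⁻', d')` for the same
`(g, ι, Ω)` have `d = d'`. So the crux's left side `2^(d + Σ_g(S₀))` depends on `(g, ι, Ω, S₀)` only.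
References: [Pollack2003] Thm. 5.1; [Washington1997] §7.1 (λ-invariant of a power series).
-/

set_option autoImplicit false
-- D-0017: single-problem summit, so `Summit.BirchSwinnertonDyer.BirchSwinnertonDyer.…` repeats a namespace BY DESIGN.
set_option linter.dupNamespace false

noncomputable section

open scoped Classical

open CongruenceSubgroup Literature.NumberTheory.EllipticCurves Literature.NumberTheory.EllipticCurves.ModularForms

namespace Summit.BirchSwinnertonDyer.BirchSwinnertonDyer.Theorems.PollackPairK

/-- **The norm-λ index is unique**: if `d` and `d'` are both "first index of a coefficient of maximal norm" of the same sequence of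
norms, then `d = d'`. [cite: Washington1997, §7.1 (λ-invariant of a power series)] -/
theorem normLambda_unique {α : Type*} (f : ℕ → α) (N : α → ℝ) {d d' : ℕ}
    (hle : ∀ k, N (f k) ≤ N (f d)) (hlt : ∀ k, k < d → N (f k) < N (f d))
    (hle' : ∀ k, N (f k) ≤ N (f d')) (hlt' : ∀ k, k < d' → N (f k) < N (f d')) : d = d' := by
  by_contra hne
  rcases Nat.lt_or_gt_of_ne hne with h | h
  · exact absurd (hle d') (not_le.mpr (hlt' d h))
  · exact absurd (hle' d) (not_le.mpr (hlt d' h))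

variable {p : ℕ} [Fact p.Prime] {M : ℕ} {g : CuspForm (Gamma0 M) 2} {ι : coeffField g →+* PadicAlgCl p} {Ω : ℂ}

/-- **The crux's exponent `d` is an invariant of `(g, ι, Ω)`**: for two `𝒪`-Pollack pairs `(L⁺, L⁻)`, `(L⁺', L⁻')` of `g` along `ι`
relative to `Ω` and exponents `d, d'` pinned to `L⁻, L⁻'` by the crux's norm binders, `d = d'` (the pair is unique,
`isPollackPairK_unique`, and the index is unique, `normLambda_unique`). [cite: Pollack2003, Thm. 5.1] -/
theorem exponent_eq_of_isPollackPairK [FiniteDimensional ℚ_[p] (padicCoeffField (Set.range ι))]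
    {Lp Lm Lp' Lm' : IwasawaAlgebraO (Set.range ι)} {d d' : ℕ}
    (h : IsPollackPairK g ι Ω Lp Lm) (h' : IsPollackPairK g ι Ω Lp' Lm')
    (hle : ∀ k : ℕ, ‖PowerSeries.coeff k (iwasawaOToPowerSeries (Set.range ι) Lm)‖ ≤
      ‖PowerSeries.coeff d (iwasawaOToPowerSeries (Set.range ι) Lm)‖)
    (hlt : ∀ k : ℕ, k < d → ‖PowerSeries.coeff k (iwasawaOToPowerSeries (Set.range ι) Lm)‖ <
      ‖PowerSeries.coeff d (iwasawaOToPowerSeries (Set.range ι) Lm)‖)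
    (hle' : ∀ k : ℕ, ‖PowerSeries.coeff k (iwasawaOToPowerSeries (Set.range ι) Lm')‖ ≤
      ‖PowerSeries.coeff d' (iwasawaOToPowerSeries (Set.range ι) Lm')‖)
    (hlt' : ∀ k : ℕ, k < d' → ‖PowerSeries.coeff k (iwasawaOToPowerSeries (Set.range ι) Lm')‖ <
      ‖PowerSeries.coeff d' (iwasawaOToPowerSeries (Set.range ι) Lm')‖) : d = d' := by
  obtain ⟨-, rfl⟩ := isPollackPairK_unique h h'
  exact normLambda_unique (fun k ↦ PowerSeries.coeff k (iwasawaOToPowerSeries (Set.range ι) Lm)) (fun x ↦ ‖x‖)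
    hle hlt hle' hlt'

end Summit.BirchSwinnertonDyer.BirchSwinnertonDyer.Theorems.PollackPairK

end
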